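import Summits.AtomisticToContinuum.FouriersLaw.Theorems.VanishingNoiseTransferNoiseLocalityStubResponseDensityNoisyAux3
import Summits.AtomisticToContinuum.FouriersLaw.Theorems.VanishingNoiseTransferNoiseLocalityStubResponseDensityNoisyAux4

/-!
# Weak `L²(μ_T)` solutions for the flip-noisy generator solve the deterministic weak equation;
the stub from (A) and a deterministic `L²`-Liouville property (helpers for stub `stub_responseDensityNoisy`)

Helper file `--supports stmt-AtomisticToContinuum-11975` (crux `NoiseLocality`, route
`VanishingNoiseTransfer`, line `relative-flip-energy-transfer`, stub 1b `stub_responseDensityNoisy`).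

Consequences of the zero flip energy of weak solutions (`flipEnergy_eq_zero_of_weak`, previous file)
for the pinned chain (`ω₂ > 0`, `lam, β ≥ 0`, `γ > 0`, `N ≥ 2`, `T > 0`, `ε > 0`) and `k ∈ L²(μ_T)`
with `∫ (L_{T,T} f + εSf) k dμ_T = 0` for all `f ∈ C_c^∞`:

* `ae_eq_comp_momentumFlip_of_weak` — `k ∘ Θ_i = k` a.e. for every site; `flipNoise_ae_eq_zero_of_weak`
  — `S k = 0` a.e.;
* `integral_generator_mul_eq_zero_of_weak` — **the noise drops out**: `∫ (L_{T,T} F) k dμ_T = 0` for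
  every `F ∈ C_c^∞` (symmetry of `S`, `integral_mul_flipNoise`);
* `of_apriori_of_liouville` (registered helper `helper_responseDensityNoisyOfAprioriOfLiouville`) — the
  stub's conclusion for `N ≥ 2`, `ε > 0` from (A) the a priori `L²(μ_T)` linear-response bound of the
  flip steady family (as in `of_apriori_of_unique`) and (U₀) the DETERMINISTIC, EQUILIBRIUM
  `L²(μ_T)`-Liouville property of the Langevin generator: a mean-zero `k ∈ L²(μ_T)` with
  `∫ (L_{T,T} F) k dμ_T = 0` for all `F ∈ C_c^∞` vanishes (the `λ = 0` endpoint of the essential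
  m-dissipativity `OddSectorIrreversibility.ae_eq_zero_of_weak_resolvent`, which is the case `λ > 0`;
  equivalently `L²`-ergodicity of `μ_T` for the equilibrium dynamics).

So after this file NOTHING about the flip-noisy dynamics is missing from the uniqueness side of the
stub: the remaining inputs are (A) (flip-noisy NESS regularity) and (U₀) (deterministic). No definitions.
-/

noncomputable section

open MeasureTheory Filter Topology
open scoped ContDiff

namespace Summit.AtomisticToContinuum.FouriersLaw.Theorems.NoiseLocality.StubResponseDensityNoisy

open Literature.MathematicalPhysics.KineticTheory.HeatConduction

variable {ω₂ lam β γ : ℝ} {N : ℕ} {T : ℝ}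

/-- Weak `L²(μ_T)` solutions for `L_{T,T} + εS` are invariant under every velocity flip:
`k ∘ Θ_i = k` a.e. -/
theorem ae_eq_comp_momentumFlip_of_weak (hω : 0 < ω₂) (hl : 0 ≤ lam) (hβ : 0 ≤ β) (hγ : 0 < γ)
    (hN : 2 ≤ N) (hT : 0 < T) {ε : ℝ} (hε : 0 < ε) {k : PhaseSpace N → ℝ}
    (hk : MemLp k 2 ((pinnedChain ω₂ lam β γ).gibbsMeasure N T))
    (hweak : ∀ f : PhaseSpace N → ℝ, ContDiff ℝ ∞ f → HasCompactSupport f →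
      ∫ x, (pinnedChain ω₂ lam β γ).flipGenerator N T T ε f x * k x
        ∂((pinnedChain ω₂ lam β γ).gibbsMeasure N T) = 0) (i : Fin N) :
    (fun x => k (momentumFlip i x)) =ᵐ[(pinnedChain ω₂ lam β γ).gibbsMeasure N T] k := by
  set π := (pinnedChain ω₂ lam β γ).gibbsMeasure N T with hπ_def
  have hΘ : MeasurePreserving (momentumFlip i) π π :=
    (pinnedChain ω₂ lam β γ).measurePreserving_momentumFlip_gibbsMeasure N T i
  have hdiff : MemLp (fun x => k (momentumFlip i x) - k x) 2 π := (hk.comp_measurePreserving hΘ).sub hk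
  have h0 := flipEnergy_eq_zero_of_weak hω hl hβ hγ hN hT hε hk hweak i
  have hsq : (fun x => (k (momentumFlip i x) - k x) ^ 2) =ᵐ[π] 0 :=
    (integral_eq_zero_iff_of_nonneg (fun x => sq_nonneg _) hdiff.integrable_sq).1 h0
  filter_upwards [hsq] with x hx
  have hx' : (k (momentumFlip i x) - k x) ^ 2 = 0 := hx
  exact sub_eq_zero.1 (pow_eq_zero_iff (n := 2) two_ne_zero |>.1 hx')

/-- Weak `L²(μ_T)` solutions for `L_{T,T} + εS` are annihilated by the flip generator: `S k = 0` a.e. -/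
theorem flipNoise_ae_eq_zero_of_weak (hω : 0 < ω₂) (hl : 0 ≤ lam) (hβ : 0 ≤ β) (hγ : 0 < γ)
    (hN : 2 ≤ N) (hT : 0 < T) {ε : ℝ} (hε : 0 < ε) {k : PhaseSpace N → ℝ}
    (hk : MemLp k 2 ((pinnedChain ω₂ lam β γ).gibbsMeasure N T))
    (hweak : ∀ f : PhaseSpace N → ℝ, ContDiff ℝ ∞ f → HasCompactSupport f →
      ∫ x, (pinnedChain ω₂ lam β γ).flipGenerator N T T ε f x * k x
        ∂((pinnedChain ω₂ lam β γ).gibbsMeasure N T) = 0) :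
    flipNoise N k =ᵐ[(pinnedChain ω₂ lam β γ).gibbsMeasure N T] 0 := by
  have hall : ∀ᵐ x ∂((pinnedChain ω₂ lam β γ).gibbsMeasure N T), ∀ i : Fin N,
      k (momentumFlip i x) = k x :=
    ae_all_iff.2 fun i => ae_eq_comp_momentumFlip_of_weak hω hl hβ hγ hN hT hε hk hweak i
  filter_upwards [hall] with x hx
  simp only [flipNoise_eq, hx, sub_self, Finset.sum_const_zero, Pi.zero_apply]

/-- **The noise drops out of the weak equation.** A weak `L²(μ_T)` solution `k` for `L_{T,T} + εS`
(`ε > 0`) solves the deterministic weak equation: `∫ (L_{T,T} F) k dμ_T = 0` for every `F ∈ C_c^∞`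
(`∫ (SF) k = ∫ F (Sk) = 0`). -/
theorem integral_generator_mul_eq_zero_of_weak (hω : 0 < ω₂) (hl : 0 ≤ lam) (hβ : 0 ≤ β)
    (hγ : 0 < γ) (hN : 2 ≤ N) (hT : 0 < T) {ε : ℝ} (hε : 0 < ε) {k : PhaseSpace N → ℝ}
    (hk : MemLp k 2 ((pinnedChain ω₂ lam β γ).gibbsMeasure N T))
    (hweak : ∀ f : PhaseSpace N → ℝ, ContDiff ℝ ∞ f → HasCompactSupport f →
      ∫ x, (pinnedChain ω₂ lam β γ).flipGenerator N T T ε f x * k x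
        ∂((pinnedChain ω₂ lam β γ).gibbsMeasure N T) = 0)
    {F : PhaseSpace N → ℝ} (hF : ContDiff ℝ ∞ F) (hFc : HasCompactSupport F) :
    ∫ x, (pinnedChain ω₂ lam β γ).generator N T T F x * k x
      ∂((pinnedChain ω₂ lam β γ).gibbsMeasure N T) = 0 := by
  set P := pinnedChain ω₂ lam β γ with hP
  set π := P.gibbsMeasure N T with hπ_def
  haveI : IsProbabilityMeasure π := pinnedChain_isProbabilityMeasure_gibbsMeasure hω hl hβ γ N hT
  have hΘ : ∀ i : Fin N, MeasurePreserving (momentumFlip i) π π := fun i =>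
    P.measurePreserving_momentumFlip_gibbsMeasure N T i
  have hF2 : ContDiff ℝ 2 F := hF.of_le (by norm_cast)
  have hFm : MemLp F 2 π := memLp_of_continuous_hasCompactSupport hF.continuous hFc π 2
  have hLm : MemLp (P.generator N T T F) 2 π :=
    memLp_of_continuous_hasCompactSupport
      (P.continuous_generator (pinnedChain_contDiff_U ω₂ lam β γ) (pinnedChain_contDiff_V ω₂ lam β γ)
        N T T hF2) (P.hasCompactSupport_generator N T T hF2 hFc) π 2
  have iFk : Integrable (fun x => F x * k x) π := hFm.integrable_mul hk
  have iLk : Integrable (fun x => P.generator N T T F x * k x) π := hLm.integrable_mul hk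
  have iSk : Integrable (fun x => flipNoise N F x * k x) π := (memLp_flipNoise hΘ hFm).integrable_mul hk
  have h0 := hweak F hF hFc
  have hsplit : ∫ x, P.flipGenerator N T T ε F x * k x ∂π =
      (∫ x, P.generator N T T F x * k x ∂π) + ε * ∫ x, flipNoise N F x * k x ∂π := by
    rw [← integral_const_mul, ← integral_add iLk (iSk.const_mul ε)]
    exact integral_congr_ae (Eventually.of_forall fun x => by
      simp only [OscillatorChain.flipGenerator_eq_add_flipNoise]
      ring)
  have hSk := flipNoise_ae_eq_zero_of_weak hω hl hβ hγ hN hT hε hk hweak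
  have hsym : ∫ x, flipNoise N F x * k x ∂π = 0 := by
    rw [← integral_mul_flipNoise hΘ iFk fun i => hFm.integrable_mul (hk.comp_measurePreserving (hΘ i))]
    have e : (fun x => F x * flipNoise N k x) =ᵐ[π] fun _ => 0 := by
      filter_upwards [hSk] with x hx
      rw [hx, Pi.zero_apply, mul_zero]
    rw [integral_congr_ae e, integral_zero]
  rw [hsplit, hsym, mul_zero, add_zero] at h0
  exact h0

/-- **The stub for `N ≥ 2`, `ε > 0`, from (A) and the deterministic Liouville property (U₀).** For the
pinned chain (`ω₂ > 0`, `lam, β ≥ 0`, `γ > 0`, `T > 0`) and the flip steady family `μ` at rate `ε > 0`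
(steady at positive temperatures, unique at `(T, T)`): (A) the a priori `L²(μ_T)` linear-response bound
and (U₀) "a mean-zero `k ∈ L²(μ_T)` with `∫ (L_{T,T} F) k dμ_T = 0` for all `F ∈ C_c^∞` vanishes"
imply the existence of the `L²(μ_T)` response density with the `HasDerivAt` clauses of the stub
(`of_apriori_of_unique` + `integral_generator_mul_eq_zero_of_weak`). -/
theorem of_apriori_of_liouville (hω : 0 < ω₂) (hl : 0 ≤ lam) (hβ : 0 ≤ β) (hγ : 0 < γ)
    (hN : 2 ≤ N) (hT : 0 < T) {ε : ℝ} (hε : 0 < ε) (μ : ℝ → ℝ → Measure (PhaseSpace N))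
    (hμ : ∀ T_L T_R : ℝ, 0 < T_L → 0 < T_R →
      (pinnedChain ω₂ lam β γ).IsFlipSteadyState N T_L T_R ε (μ T_L T_R) ∧
        ∀ ν : Measure (PhaseSpace N),
          (pinnedChain ω₂ lam β γ).IsFlipSteadyState N T_L T_R ε ν → ν = μ T_L T_R)
    (hA : ∃ C : ℝ, ∀ᶠ δ in 𝓝[≠] (0 : ℝ), ∃ k : PhaseSpace N → ℝ,
      MemLp k 2 ((pinnedChain ω₂ lam β γ).gibbsMeasure N T) ∧
        ∫ x, k x ^ 2 ∂((pinnedChain ω₂ lam β γ).gibbsMeasure N T) ≤ C ∧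
        ∀ F : PhaseSpace N → ℝ, MemLp F 2 ((pinnedChain ω₂ lam β γ).gibbsMeasure N T) →
          Integrable F (μ (T + δ / 2) (T - δ / 2)) ∧
            ∫ x, F x ∂(μ (T + δ / 2) (T - δ / 2)) =
              ∫ x, F x ∂((pinnedChain ω₂ lam β γ).gibbsMeasure N T) +
                δ * ∫ x, F x * k x ∂((pinnedChain ω₂ lam β γ).gibbsMeasure N T))
    (hU₀ : ∀ k : PhaseSpace N → ℝ, MemLp k 2 ((pinnedChain ω₂ lam β γ).gibbsMeasure N T) →
      ∫ x, k x ∂((pinnedChain ω₂ lam β γ).gibbsMeasure N T) = 0 →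
        (∀ F : PhaseSpace N → ℝ, ContDiff ℝ ∞ F → HasCompactSupport F →
          ∫ x, (pinnedChain ω₂ lam β γ).generator N T T F x * k x
            ∂((pinnedChain ω₂ lam β γ).gibbsMeasure N T) = 0) →
        k =ᵐ[(pinnedChain ω₂ lam β γ).gibbsMeasure N T] 0) :
    ∃ U : PhaseSpace N → ℝ,
      MemLp U 2 ((pinnedChain ω₂ lam β γ).gibbsMeasure N T) ∧
        (∀ g : PhaseSpace N → ℝ, ContDiff ℝ ((⊤ : ℕ∞) : WithTop ℕ∞) g → HasCompactSupport g →
            HasDerivAt (fun δ : ℝ => ∫ x, g x ∂(μ (T + δ / 2) (T - δ / 2)))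
              (∫ x, g x * U x ∂((pinnedChain ω₂ lam β γ).gibbsMeasure N T)) 0) ∧
        HasDerivAt (fun δ : ℝ => (pinnedChain ω₂ lam β γ).totalCurrent (μ (T + δ / 2) (T - δ / 2)))
          (∑ i : Fin N, ∫ x, (pinnedChain ω₂ lam β γ).bondCurrent N i x * U x
            ∂((pinnedChain ω₂ lam β γ).gibbsMeasure N T)) 0 :=
  of_apriori_of_unique hω hl hβ γ N hT ε μ hμ hA fun k hk hk0 hkw =>
    hU₀ k hk hk0 fun _ hF hFc => integral_generator_mul_eq_zero_of_weak hω hl hβ hγ hN hT hε hk hkw hF hFc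

/-! ### Registered helper sub-goal (stub form, one line) -/

/-- Registered helper sub-goal `helper_responseDensityNoisyOfAprioriOfLiouville` of stub
`stub_responseDensityNoisy` (= `of_apriori_of_liouville` in stub form): the stub for `N ≥ 2`, `ε > 0` from
(A) the a priori `L²(μ_T)` linear-response bound of the flip steady family and (U₀) the deterministic
equilibrium `L²(μ_T)`-Liouville property. -/
theorem helper_responseDensityNoisyOfAprioriOfLiouville : ∀ ω₂ lam β γ : ℝ, 0 < ω₂ → 0 ≤ lam → 0 ≤ β → 0 < γ → ∀ (N : ℕ), 2 ≤ N → ∀ (T : ℝ), 0 < T → ∀ (ε : ℝ), 0 < ε → ∀ (μ : ℝ → ℝ → MeasureTheory.Measure (Literature.MathematicalPhysics.KineticTheory.HeatConduction.PhaseSpace N)), (∀ T_L T_R : ℝ, 0 < T_L → 0 < T_R → (Literature.MathematicalPhysics.KineticTheory.HeatConduction.pinnedChain ω₂ lam β γ).IsFlipSteadyState N T_L T_R ε (μ T_L T_R) ∧ ∀ ν : MeasureTheory.Measure (Literature.MathematicalPhysics.KineticTheory.HeatConduction.PhaseSpace N), (Literature.MathematicalPhysics.KineticTheory.HeatConduction.pinnedChain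 ω₂ lam β γ).IsFlipSteadyState N T_L T_R ε ν → ν = μ T_L T_R) → (∃ C : ℝ, ∀ᶠ δ in nhdsWithin (0 : ℝ) {(0 : ℝ)}ᶜ, ∃ k : Literature.MathematicalPhysics.KineticTheory.HeatConduction.PhaseSpace N → ℝ, MeasureTheory.MemLp k 2 ((Literature.MathematicalPhysics.KineticTheory.HeatConduction.pinnedChain ω₂ lam β γ).gibbsMeasure N T) ∧ ∫ x, k x ^ 2 ∂((Literature.MathematicalPhysics.KineticTheory.HeatConduction.pinnedChain ω₂ lam β γ).gibbsMeasure N T) ≤ C ∧ ∀ F : Literature.MathematicalPhysics.KineticTheory.HeatConduction.PhaseSpace N → ℝ, MeasureTheory.MemLp F 2 ((Literature.MathematicalPhysics.KineticTheory.HeatConduction.pinnedChain ω₂ lam β γ).gibbsMeasure N T) → MeasureTheory.Integrable F (μ (T + δ / 2) (T - δ / 2)) ∧ ∫ x, F x ∂(μ (T + δ / 2) (T - δ / 2)) = ∫ x, F x ∂((Literature.MathematicalPhysics.KineticTheory.HeatConduction.pinnedChain ω₂ lam β γ).gibbsMeasure N T) + δ * ∫ x, F x * k x ∂((Literature.MathematicalPhysics.KineticTheory.HeatConduction.pinnedChain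 ω₂ lam β γ).gibbsMeasure N T)) → (∀ k : Literature.MathematicalPhysics.KineticTheory.HeatConduction.PhaseSpace N → ℝ, MeasureTheory.MemLp k 2 ((Literature.MathematicalPhysics.KineticTheory.HeatConduction.pinnedChain ω₂ lam β γ).gibbsMeasure N T) → ∫ x, k x ∂((Literature.MathematicalPhysics.KineticTheory.HeatConduction.pinnedChain ω₂ lam β γ).gibbsMeasure N T) = 0 → (∀ F : Literature.MathematicalPhysics.KineticTheory.HeatConduction.PhaseSpace N → ℝ, ContDiff ℝ ((⊤ : ℕ∞) : WithTop ℕ∞) F → HasCompactSupport F → ∫ x, (Literature.MathematicalPhysics.KineticTheory.HeatConduction.pinnedChain ω₂ lam β γ).generator N T T F x * k x ∂((Literature.MathematicalPhysics.KineticTheory.HeatConduction.pinnedChain ω₂ lam β γ).gibbsMeasure N T) = 0) → Filter.EventuallyEq (MeasureTheory.ae ((Literature.MathematicalPhysics.KineticTheory.HeatConduction.pinnedChain ω₂ lam β γ).gibbsMeasure N T)) k 0) → ∃ U : Literature.MathematicalPhysics.KineticTheory.HeatConduction.PhaseSpace N → ℝ, MeasureTheory.MemLp U 2 ((Literature.MathematicalPhysics.KineticTheory.HeatConduction.pinnedChain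 ω₂ lam β γ).gibbsMeasure N T) ∧ (∀ g : Literature.MathematicalPhysics.KineticTheory.HeatConduction.PhaseSpace N → ℝ, ContDiff ℝ ((⊤ : ℕ∞) : WithTop ℕ∞) g → HasCompactSupport g → HasDerivAt (fun δ : ℝ => ∫ x, g x ∂(μ (T + δ / 2) (T - δ / 2))) (∫ x, g x * U x ∂((Literature.MathematicalPhysics.KineticTheory.HeatConduction.pinnedChain ω₂ lam β γ).gibbsMeasure N T)) 0) ∧ HasDerivAt (fun δ : ℝ => (Literature.MathematicalPhysics.KineticTheory.HeatConduction.pinnedChain ω₂ lam β γ).totalCurrent (μ (T + δ / 2) (T - δ / 2))) (∑ i : Fin N, ∫ x, (Literature.MathematicalPhysics.KineticTheory.HeatConduction.pinnedChain ω₂ lam β γ).bondCurrent N i x * U x ∂((Literature.MathematicalPhysics.KineticTheory.HeatConduction.pinnedChain ω₂ lam β γ).gibbsMeasure N T)) 0 :=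
  fun _ _ _ _ hω hl hβ hγ _ hN _ hT _ hε μ hμ hA hU₀ => of_apriori_of_liouville hω hl hβ hγ hN hT hε μ hμ hA hU₀

end Summit.AtomisticToContinuum.FouriersLaw.Theorems.NoiseLocality.StubResponseDensityNoisy

end
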